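import Summits.QuantumAdvantage.QuantumAdvantage.Theorems.InnerDegreeLawsB

set_option linter.dupNamespace false

/-!
# LIVENESS SEPARATION (lens 4, g28 cycle 4) — the flat-walk law for two registers of the chain

Blocker `X = AbsorptionDial.NoPerfectPolyOdd` (item 28487); rung-2 piece `TwoQuadNoPerfectOdd` (node-only Prop, g27/g28).  Kernel content of
NODE-g28.md §5d:

* `blockEmb a m h : Fin m ↪ Fin n` — the interval block `[a, a+m)` of coordinates;
* FLAT WALK (`walkExp_fill_block_right/left`): if the whole free block lies on one side of cut `g`, the walk exponent on the subcube
  `fill ρ (blockEmb a m h) v` is `frozenExp ρ _ g + e·|v|` with `e = 1` (cut left of the block, `g ≤ a`) or `e = 2` (cut right of the block,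
  `a + m ≤ g`);
* `frozenExp_allFalse`, `frozenExp_single` — the frozen constant of the all-zero freezing and of a one-point freezing;
* **`flat_separation`** — for cuts `g₁ < g₂` NOT in the ends configuration `(g₁, g₂) = (0, n) ∧ n ≡ c (mod 3)` there is an interval block of
  length `m ≥ n/3` on which both walks are flat, a freezing `ρ` (all zero, or one toggled bit outside the block) and a residue `τ` such that on
  the whole class `{v : |v| ≡ τ (mod 3)}` of the block cut `g₁` is DEAD and cut `g₂` is LIVE (`liveCut`);
* `coLive_ends` — conversely, in the ends configuration cuts `0` and `n` are live at exactly the same inputs.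

Mechanism: `s_{g₂}(u) − s_{g₁}(u) ≡ (g₂ − g₁) + Σ_{g₁ ≤ i < g₂} u_i (mod 3)`; on a flat block the two phases are `a_r + e_r|v|`; the `ℤ₃`
bookkeeping is discharged by `omega`.  Paper use (NODE-g28 §5d, claim T1): off the ends configuration `TwoQuadNoPerfectOdd` reduces to the
one-quadratic law (c0) run inside the block on the class where the second quadratic register is dead.
-/

open Finset
open Summit.QuantumAdvantage.AdviceFreeQNC0
open Summit.QuantumAdvantage.QuantumAdvantage.Theorems.InnerDegreeDial

namespace Summit.QuantumAdvantage.QuantumAdvantage.Theorems.LivenessSeparation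

variable {n : ℕ}

/-! ### §1 Interval blocks and flat walks -/

/-- the interval block `[a, a+m)` of coordinates, as an embedding `Fin m ↪ Fin n` -/
def blockEmb (a m : ℕ) (h : a + m ≤ n) : Fin m ↪ Fin n :=
  ⟨fun j => ⟨a + j.val, by omega⟩, fun j j' hjj => by
    simp only [Fin.mk.injEq] at hjj
    exact Fin.ext (by omega)⟩

/-- the block embedding on values -/
@[simp] theorem blockEmb_val (a m : ℕ) (h : a + m ≤ n) (j : Fin m) : (blockEmb a m h j).val = a + j.val := rfl

/-- a coordinate left of the block is frozen -/
theorem not_mem_blockEmb_of_lt (a m : ℕ) (h : a + m ≤ n) (i : Fin n) (hi : i.val < a) :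
    i ∉ univ.map (blockEmb a m h) := by
  intro hmem
  obtain ⟨j, _, hj⟩ := mem_map.mp hmem
  have := congrArg Fin.val hj
  simp only [blockEmb_val] at this
  omega

/-- a coordinate right of the block is frozen -/
theorem not_mem_blockEmb_of_le (a m : ℕ) (h : a + m ≤ n) (i : Fin n) (hi : a + m ≤ i.val) :
    i ∉ univ.map (blockEmb a m h) := by
  intro hmem
  obtain ⟨j, _, hj⟩ := mem_map.mp hmem
  have := congrArg Fin.val hj
  simp only [blockEmb_val] at this
  omega

/-- walk weight of a coordinate left of the cut -/
theorem ww_eq_two {g : ℕ} {i : Fin n} (h : i.val < g) : Coset21.CharTwoKill.ww g i = 2 := by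
  unfold Coset21.CharTwoKill.ww; rw [if_pos h]

/-- walk weight of a coordinate right of (or at) the cut -/
theorem ww_eq_one {g : ℕ} {i : Fin n} (h : g ≤ i.val) : Coset21.CharTwoKill.ww g i = 1 := by
  unfold Coset21.CharTwoKill.ww; rw [if_neg (by omega)]

/-- **FLAT WALK, cut left of the block** (`g ≤ a`): every free coordinate weighs `1` -/
theorem walkExp_fill_block_right {m : ℕ} (ρ : Fin n → Bool) (a : ℕ) (h : a + m ≤ n) (g : ℕ) (hg : g ≤ a) (v : Fin m → Bool) :
    walkExp (fill ρ (blockEmb a m h) v) g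
      = frozenExp ρ (blockEmb a m h) g + (univ.filter fun j => v j = true).card := by
  rw [walkExp_fill, card_eq_sum_ones, sum_filter]
  congr 1
  refine sum_congr rfl fun j _ => ?_
  rw [ww_eq_one (by simp only [blockEmb_val]; omega)]

/-- **FLAT WALK, cut right of the block** (`a + m ≤ g`): every free coordinate weighs `2` -/
theorem walkExp_fill_block_left {m : ℕ} (ρ : Fin n → Bool) (a : ℕ) (h : a + m ≤ n) (g : ℕ) (hg : a + m ≤ g) (v : Fin m → Bool) :
    walkExp (fill ρ (blockEmb a m h) v) g
      = frozenExp ρ (blockEmb a m h) g + 2 * (univ.filter fun j => v j = true).card := by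
  rw [walkExp_fill, card_eq_sum_ones, mul_sum, sum_filter]
  congr 1
  refine sum_congr rfl fun j _ => ?_
  rw [ww_eq_two (by simp only [blockEmb_val]; omega)]
  split_ifs <;> simp

/-- the all-zero freezing contributes nothing -/
theorem frozenExp_allFalse {m : ℕ} (T : Fin m ↪ Fin n) (g : ℕ) : frozenExp (fun _ => false) T g = 0 := by
  unfold frozenExp
  simp

/-- a one-point freezing at a frozen coordinate `i₀` contributes exactly `ww g i₀` -/
theorem frozenExp_single {m : ℕ} (T : Fin m ↪ Fin n) (g : ℕ) (i₀ : Fin n) (hi₀ : i₀ ∉ univ.map T) :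
    frozenExp (fun i => decide (i = i₀)) T g = Coset21.CharTwoKill.ww g i₀ := by
  unfold frozenExp
  rw [sum_eq_single_of_mem i₀ (mem_compl.mpr hi₀)]
  · simp
  · intro b _ hb
    simp [hb]

/-! ### §2 Flat separation of two cuts -/

/-- dead/live from the two residues -/
theorem liveCut_dead_live_of {u : Fin n → Bool} {c : ℕ} {g₁ g₂ : Fin (n + 1)}
    (h₁ : (c + g₁.val + walkExp u g₁.val) % 3 = 0) (h₂ : (c + g₂.val + walkExp u g₂.val) % 3 ≠ 0) :
    liveCut c u g₁ = false ∧ liveCut c u g₂ = true := by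
  refine ⟨?_, ?_⟩
  · unfold liveCut; exact decide_eq_false (by rw [h₁]; decide)
  · unfold liveCut; exact decide_eq_true h₂

/-- **FLAT SEPARATION LAW.**  Cuts `g₁ < g₂` of the `(n+1)`-register chain, not in the ends configuration
`g₁ = 0 ∧ g₂ = n ∧ n ≡ c (mod 3)`.  Then there is an interval block `[a, a+m)` with `3m ≥ n` lying on one side of each of the two cuts
(both walks flat on it), a freezing `ρ` of its complement and a residue `τ` such that at EVERY point of the subcube whose free weight is
`≡ τ (mod 3)` cut `g₁` is dead and cut `g₂` is live.  (The three candidate blocks are `[0,g₁)`, `[g₂,n)`, `[g₁,g₂)`; `ρ` is all-zero or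
the indicator of one coordinate among `g₁`, `0`, `n−1`.) -/
theorem flat_separation (c : ℕ) (g₁ g₂ : Fin (n + 1)) (hlt : g₁ < g₂)
    (hends : ¬ (g₁.val = 0 ∧ g₂.val = n ∧ n % 3 = c % 3)) :
    ∃ a m, ∃ h : a + m ≤ n, n ≤ 3 * m ∧
      ((g₁.val ≤ a ∨ a + m ≤ g₁.val) ∧ (g₂.val ≤ a ∨ a + m ≤ g₂.val)) ∧
      ∃ (ρ : Fin n → Bool) (τ : ℕ), ∀ v : Fin m → Bool, (univ.filter fun j => v j = true).card % 3 = τ % 3 →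
        liveCut c (fill ρ (blockEmb a m h) v) g₁ = false ∧ liveCut c (fill ρ (blockEmb a m h) v) g₂ = true := by
  have h12 : g₁.val < g₂.val := hlt
  have h2n : g₂.val ≤ n := by have := g₂.isLt; omega
  by_cases hL : n ≤ 3 * g₁.val
  · -- block `[0, g₁)`: both cuts right of the block, both weights `2`; toggle coordinate `g₁` iff `g₁ ≡ g₂`
    have hb : 0 + g₁.val ≤ n := by omega
    refine ⟨0, g₁.val, hb, by omega, ⟨Or.inr (by omega), Or.inr (by omega)⟩, ?_⟩
    let i₀ : Fin n := ⟨g₁.val, by omega⟩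
    have hi₀ : i₀ ∉ univ.map (blockEmb 0 g₁.val hb) := not_mem_blockEmb_of_le _ _ _ _ (by simp [i₀])
    by_cases hmod : g₁.val % 3 = g₂.val % 3
    · refine ⟨fun i => decide (i = i₀), c + g₁.val + 1, fun v hv => ?_⟩
      have hw₁ := walkExp_fill_block_left (fun i => decide (i = i₀)) 0 hb g₁.val (by omega) v
      have hw₂ := walkExp_fill_block_left (fun i => decide (i = i₀)) 0 hb g₂.val (by omega) v
      rw [frozenExp_single _ _ i₀ hi₀, ww_eq_one (by simp [i₀])] at hw₁
      rw [frozenExp_single _ _ i₀ hi₀, ww_eq_two (by simp [i₀]; omega)] at hw₂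
      exact liveCut_dead_live_of (by rw [hw₁]; omega) (by rw [hw₂]; omega)
    · refine ⟨fun _ => false, c + g₁.val, fun v hv => ?_⟩
      have hw₁ := walkExp_fill_block_left (fun _ => false) 0 hb g₁.val (by omega) v
      have hw₂ := walkExp_fill_block_left (fun _ => false) 0 hb g₂.val (by omega) v
      rw [frozenExp_allFalse] at hw₁ hw₂
      exact liveCut_dead_live_of (by rw [hw₁]; omega) (by rw [hw₂]; omega)
  · by_cases hR : n ≤ 3 * (n - g₂.val)
    · -- block `[g₂, n)`: both cuts left of the block, both weights `1`; toggle coordinate `g₁` iff `g₁ ≡ g₂`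
      have hb : g₂.val + (n - g₂.val) ≤ n := by omega
      refine ⟨g₂.val, n - g₂.val, hb, by omega, ⟨Or.inl (by omega), Or.inl (by omega)⟩, ?_⟩
      let i₀ : Fin n := ⟨g₁.val, by omega⟩
      have hi₀ : i₀ ∉ univ.map (blockEmb g₂.val (n - g₂.val) hb) := not_mem_blockEmb_of_lt _ _ _ _ (by simp [i₀]; omega)
      by_cases hmod : g₁.val % 3 = g₂.val % 3
      · refine ⟨fun i => decide (i = i₀), 2 * (c + g₁.val + 1), fun v hv => ?_⟩
        have hw₁ := walkExp_fill_block_right (fun i => decide (i = i₀)) g₂.val hb g₁.val (by omega) v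
        have hw₂ := walkExp_fill_block_right (fun i => decide (i = i₀)) g₂.val hb g₂.val (by omega) v
        rw [frozenExp_single _ _ i₀ hi₀, ww_eq_one (by simp [i₀])] at hw₁
        rw [frozenExp_single _ _ i₀ hi₀, ww_eq_two (by simp [i₀]; omega)] at hw₂
        exact liveCut_dead_live_of (by rw [hw₁]; omega) (by rw [hw₂]; omega)
      · refine ⟨fun _ => false, 2 * (c + g₁.val), fun v hv => ?_⟩
        have hw₁ := walkExp_fill_block_right (fun _ => false) g₂.val hb g₁.val (by omega) v
        have hw₂ := walkExp_fill_block_right (fun _ => false) g₂.val hb g₂.val (by omega) v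
        rw [frozenExp_allFalse] at hw₁ hw₂
        exact liveCut_dead_live_of (by rw [hw₁]; omega) (by rw [hw₂]; omega)
    · -- block `[g₁, g₂)` (the middle): `g₁` left of the block (weight `1`), `g₂` right of it (weight `2`)
      have hb : g₁.val + (g₂.val - g₁.val) ≤ n := by omega
      refine ⟨g₁.val, g₂.val - g₁.val, hb, by omega, ⟨Or.inl (by omega), Or.inr (by omega)⟩, ?_⟩
      by_cases hbad : (c + g₂.val) % 3 = (2 * (c + g₁.val)) % 3
      · -- the phases sit on the bad line: toggle one bit OUTSIDE the middle block
        by_cases hg : 0 < g₁.val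
        · -- coordinate `0` (weight `2` for both cuts)
          let i₀ : Fin n := ⟨0, by omega⟩
          have hv0 : i₀.val = 0 := rfl
          have hi₀ : i₀ ∉ univ.map (blockEmb g₁.val (g₂.val - g₁.val) hb) :=
            not_mem_blockEmb_of_lt _ _ _ _ (by rw [hv0]; exact hg)
          refine ⟨fun i => decide (i = i₀), 2 * (c + g₁.val + 2), fun v hv => ?_⟩
          have hw₁ := walkExp_fill_block_right (fun i => decide (i = i₀)) g₁.val hb g₁.val (by omega) v
          have hw₂ := walkExp_fill_block_left (fun i => decide (i = i₀)) g₁.val hb g₂.val (by omega) v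
          rw [frozenExp_single _ _ i₀ hi₀, ww_eq_two (by rw [hv0]; exact hg)] at hw₁
          rw [frozenExp_single _ _ i₀ hi₀, ww_eq_two (by rw [hv0]; omega)] at hw₂
          exact liveCut_dead_live_of (by rw [hw₁]; omega) (by rw [hw₂]; omega)
        · by_cases hg2 : g₂.val < n
          · -- coordinate `n − 1` (weight `1` for both cuts)
            let i₀ : Fin n := ⟨n - 1, by omega⟩
            have hi₀ : i₀ ∉ univ.map (blockEmb g₁.val (g₂.val - g₁.val) hb) :=
              not_mem_blockEmb_of_le _ _ _ _ (by simp [i₀]; omega)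
            refine ⟨fun i => decide (i = i₀), 2 * (c + g₁.val + 1), fun v hv => ?_⟩
            have hw₁ := walkExp_fill_block_right (fun i => decide (i = i₀)) g₁.val hb g₁.val (by omega) v
            have hw₂ := walkExp_fill_block_left (fun i => decide (i = i₀)) g₁.val hb g₂.val (by omega) v
            rw [frozenExp_single _ _ i₀ hi₀, ww_eq_one (by simp [i₀]; omega)] at hw₁
            rw [frozenExp_single _ _ i₀ hi₀, ww_eq_one (by simp [i₀]; omega)] at hw₂
            exact liveCut_dead_live_of (by rw [hw₁]; omega) (by rw [hw₂]; omega)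
          · -- the ends configuration with `n ≡ c`: excluded
            exfalso
            exact hends ⟨by omega, by omega, by omega⟩
      · refine ⟨fun _ => false, 2 * (c + g₁.val), fun v hv => ?_⟩
        have hw₁ := walkExp_fill_block_right (fun _ => false) g₁.val hb g₁.val (by omega) v
        have hw₂ := walkExp_fill_block_left (fun _ => false) g₁.val hb g₂.val (by omega) v
        rw [frozenExp_allFalse] at hw₁ hw₂
        exact liveCut_dead_live_of (by rw [hw₁]; omega) (by rw [hw₂]; omega)

/-- **THE ENDS ARE CO-LIVE.**  In the ends configuration (`n ≡ c (mod 3)`) cuts `0` and `n` are live at exactly the same inputs: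
`s_0 = c + |u|`, `s_n = c + n + 2|u|`, and `c + n + 2|u| ≡ 2(c + |u|)`. -/
theorem coLive_ends (c : ℕ) (hn : n % 3 = c % 3) (u : Fin n → Bool) :
    liveCut c u (0 : Fin (n + 1)) = liveCut c u (Fin.last n) := by
  have h0 : walkExp u 0 = (univ.filter fun i => u i = true).card := by
    rw [Coset21.CharTwoKill.walkExp_eq_sum, card_eq_sum_ones, sum_filter]
    refine sum_congr rfl fun i _ => ?_
    rw [ww_eq_one (Nat.zero_le _)]
  have hn' : walkExp u n = 2 * (univ.filter fun i => u i = true).card := by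
    rw [Coset21.CharTwoKill.walkExp_eq_sum, card_eq_sum_ones, mul_sum, sum_filter]
    refine sum_congr rfl fun i _ => ?_
    rw [ww_eq_two i.isLt]
    split_ifs <;> simp
  have key : ((c + (0 : Fin (n + 1)).val + walkExp u (0 : Fin (n + 1)).val) % 3 ≠ 0)
      ↔ ((c + (Fin.last n).val + walkExp u (Fin.last n).val) % 3 ≠ 0) := by
    simp only [Fin.val_zero, Fin.val_last]
    rw [h0, hn']
    omega
  unfold liveCut
  exact decide_eq_decide.mpr key

/-! ### §3 Sanity -/

/-- the block `[1, 3)` of `Fin 5` -/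
example : ((blockEmb (n := 5) 1 2 (by norm_num)) ⟨1, by norm_num⟩).val = 2 := rfl

end Summit.QuantumAdvantage.QuantumAdvantage.Theorems.LivenessSeparation
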